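import Mathlib
import Summits.Ventures.PercRepro2.TypedStarGroups

/-!
# ONE UNMARKED STAR VERTEX OVER AN ALL-MARKED BASE, IV: THE PIECES — THE CERTIFICATE LIST FOR
`StarNonneg` (blind cell PercRepro2, p2 g2, 2026-08-25; sub-claim S1 (C); mine-1's §23.1 identities
read on the masked counts, and the census of which copy-symmetrised pieces are separately `≥ 0`)

The placement sums `starSum` (TypedStarK5.lean) are integer combinations of COPY-SYMMETRISED
PIECES — sums of `mcount` over the orderings of a mask multiset (the kernel is copy-asymmetric, so
the single placements are not nonnegative; the symmetrised pieces are mine-1's objects):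
`pN = N(H)`, `pE S = N(H + e(1))`, `pE2 S = N(H + e(2))`, `pT1 = N(H + T(1))`, `pT2 = N(H + T(2))`,
`pM S = M(H, T, e)` (`T` in one copy, the pair `e` in another), `pC S S'` (two different pairs in two
copies), `pB` (the three pairs in the three copies).  The eight decompositions `starSum_111_pieces …
starSum_222_pieces` are mine-1's §23.1 identities (e.g. `(2,2,2) = pT2 + pB + Σ_e pM e`, i.e.
`N(H + T(2)) + [N(H + △(1,1,1)) − N(H + T(1))]`).

**`StarPieces R o a₁ a₂ a₃ b p₁ p₂ p₃`** is the list of statements typer-1 certifies for one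
`(marking, T)` — each a small Kronecker certificate (≤ 12 mask-products per kernel term): `pN`, the
three `pE`, the three `pE2`, `pT1`, `pT2`, the three `pM`, the three `pC S S' + pT1`
(`= N(H + e(1) + e'(1))`), and ONE `pB + pM S*` (the census: for every `T` some pair `S*` makes
`pB + pM S*` nonnegative on every profile, while `pB` alone is not) — and
**`starNonneg_of_pieces`** turns it into `StarNonneg` at all eight type vectors.

Own code; standard axioms; no certificate here.
-/

namespace Summit.Ventures.PercRepro2

open Hub

namespace K5

/-! ## The pieces -/

section Pieces

variable {R : Type*} [Field R]
variable (F : Finset (Fin 10)) (z : Config (Fin 10)) (τ : Fin 10 → ℕ)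
  (K : Config (Fin 10) → Config (Fin 10) → Config (Fin 10) → R)

/-- `N(H)`: no mask. -/
noncomputable def pN : R := mcount F z τ mNone mNone mNone K

/-- `N(H + e(1))`: the object `S` open in exactly one copy. -/
noncomputable def pE (S : Fin 10 → Bool) : R :=
  mcount F z τ S mNone mNone K + mcount F z τ mNone S mNone K + mcount F z τ mNone mNone S K

/-- `N(H + e(2))`: the object `S` open in exactly two copies. -/
noncomputable def pE2 (S : Fin 10 → Bool) : R :=
  mcount F z τ S S mNone K + mcount F z τ S mNone S K + mcount F z τ mNone S S K

/-- `M(H, T, e)`: the triangle `T` open in one copy, the pair `S` in another (six ordered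
placements). -/
noncomputable def pM (T S : Fin 10 → Bool) : R :=
  mcount F z τ T S mNone K + mcount F z τ T mNone S K + mcount F z τ S T mNone K +
    mcount F z τ mNone T S K + mcount F z τ S mNone T K + mcount F z τ mNone S T K

/-- Two different pairs in two different copies (six ordered placements). -/
noncomputable def pC (S S' : Fin 10 → Bool) : R :=
  mcount F z τ S S' mNone K + mcount F z τ S mNone S' K + mcount F z τ S' S mNone K +
    mcount F z τ mNone S S' K + mcount F z τ S' mNone S K + mcount F z τ mNone S' S K

/-- The three pairs in the three copies (six placements). -/
noncomputable def pB (S₁ S₂ S₃ : Fin 10 → Bool) : R :=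
  mcount F z τ S₁ S₂ S₃ K + mcount F z τ S₁ S₃ S₂ K + mcount F z τ S₂ S₁ S₃ K +
    mcount F z τ S₂ S₃ S₁ K + mcount F z τ S₃ S₁ S₂ K + mcount F z τ S₃ S₂ S₁ K

end Pieces

/-! ## The decompositions (mine-1's §23.1 identities on the masked counts) -/

section Decomp

variable {R : Type*} [Field R]
variable (F : Finset (Fin 10)) (z : Config (Fin 10)) (τ : Fin 10 → ℕ) (p₁ p₂ p₃ : Fin 5)
  (K : Config (Fin 10) → Config (Fin 10) → Config (Fin 10) → R)

/-- `(1,1,1) = 6 N(H) + 2 Σ_e N(H + e(1)) + N(H + T(1))`. -/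
theorem starSum_111_pieces :
    starSum F z τ p₁ p₂ p₃ 1 1 1 K =
      6 * pN F z τ K + 2 * (pE F z τ K (pairMask p₁ p₂) + pE F z τ K (pairMask p₁ p₃) +
        pE F z τ K (pairMask p₂ p₃)) + pE F z τ K (triMask p₁ p₂ p₃) := by
  rw [starSum_111]; unfold pN pE; ring

/-- `(1,1,2) = N(H + e₁₂(1)) + 2 N(H + e₁₃(1)) + 2 N(H + e₂₃(1)) + N(H + T(1)) + [pC e₁₃ e₂₃ + N(H + T(1))]`. -/
theorem starSum_112_pieces :
    starSum F z τ p₁ p₂ p₃ 1 1 2 K =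
      pE F z τ K (pairMask p₁ p₂) + 2 * pE F z τ K (pairMask p₁ p₃) + 2 * pE F z τ K (pairMask p₂ p₃) +
        pE F z τ K (triMask p₁ p₂ p₃) +
        (pC F z τ K (pairMask p₁ p₃) (pairMask p₂ p₃) + pE F z τ K (triMask p₁ p₂ p₃)) := by
  rw [starSum_112]; unfold pE pC; ring

/-- `(1,2,1)`. -/
theorem starSum_121_pieces :
    starSum F z τ p₁ p₂ p₃ 1 2 1 K =
      2 * pE F z τ K (pairMask p₁ p₂) + pE F z τ K (pairMask p₁ p₃) + 2 * pE F z τ K (pairMask p₂ p₃) +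
        pE F z τ K (triMask p₁ p₂ p₃) +
        (pC F z τ K (pairMask p₁ p₂) (pairMask p₂ p₃) + pE F z τ K (triMask p₁ p₂ p₃)) := by
  rw [starSum_121]; unfold pE pC; ring

/-- `(2,1,1)`. -/
theorem starSum_211_pieces :
    starSum F z τ p₁ p₂ p₃ 2 1 1 K =
      2 * pE F z τ K (pairMask p₁ p₂) + 2 * pE F z τ K (pairMask p₁ p₃) + pE F z τ K (pairMask p₂ p₃) +
        pE F z τ K (triMask p₁ p₂ p₃) +
        (pC F z τ K (pairMask p₁ p₂) (pairMask p₁ p₃) + pE F z τ K (triMask p₁ p₂ p₃)) := by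
  rw [starSum_211]; unfold pE pC; ring

/-- `(1,2,2) = N(H + e₂₃(2)) + M(H, T, e₂₃) + [pC e₁₂ e₂₃ + N(H + T(1))] + [pC e₁₃ e₂₃ + N(H + T(1))]`. -/
theorem starSum_122_pieces :
    starSum F z τ p₁ p₂ p₃ 1 2 2 K =
      pE2 F z τ K (pairMask p₂ p₃) + pM F z τ K (triMask p₁ p₂ p₃) (pairMask p₂ p₃) +
        (pC F z τ K (pairMask p₁ p₂) (pairMask p₂ p₃) + pE F z τ K (triMask p₁ p₂ p₃)) +
        (pC F z τ K (pairMask p₁ p₃) (pairMask p₂ p₃) + pE F z τ K (triMask p₁ p₂ p₃)) := by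
  rw [starSum_122]; unfold pE pE2 pM pC; ring

/-- `(2,1,2)`. -/
theorem starSum_212_pieces :
    starSum F z τ p₁ p₂ p₃ 2 1 2 K =
      pE2 F z τ K (pairMask p₁ p₃) + pM F z τ K (triMask p₁ p₂ p₃) (pairMask p₁ p₃) +
        (pC F z τ K (pairMask p₁ p₂) (pairMask p₁ p₃) + pE F z τ K (triMask p₁ p₂ p₃)) +
        (pC F z τ K (pairMask p₁ p₃) (pairMask p₂ p₃) + pE F z τ K (triMask p₁ p₂ p₃)) := by
  rw [starSum_212]; unfold pE pE2 pM pC; ring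

/-- `(2,2,1)`. -/
theorem starSum_221_pieces :
    starSum F z τ p₁ p₂ p₃ 2 2 1 K =
      pE2 F z τ K (pairMask p₁ p₂) + pM F z τ K (triMask p₁ p₂ p₃) (pairMask p₁ p₂) +
        (pC F z τ K (pairMask p₁ p₂) (pairMask p₁ p₃) + pE F z τ K (triMask p₁ p₂ p₃)) +
        (pC F z τ K (pairMask p₁ p₂) (pairMask p₂ p₃) + pE F z τ K (triMask p₁ p₂ p₃)) := by
  rw [starSum_221]; unfold pE pE2 pM pC; ring

/-- `(2,2,2) = N(H + T(2)) + pB + Σ_e M(H, T, e)` — `N(H + T(2)) + [N(H + △(1,1,1)) − N(H + T(1))]`. -/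
theorem starSum_222_pieces :
    starSum F z τ p₁ p₂ p₃ 2 2 2 K =
      pE2 F z τ K (triMask p₁ p₂ p₃) + pB F z τ K (pairMask p₁ p₂) (pairMask p₁ p₃) (pairMask p₂ p₃) +
        (pM F z τ K (triMask p₁ p₂ p₃) (pairMask p₁ p₂) + pM F z τ K (triMask p₁ p₂ p₃) (pairMask p₁ p₃) +
          pM F z τ K (triMask p₁ p₂ p₃) (pairMask p₂ p₃)) := by
  rw [starSum_222]; unfold pE2 pM pB; ring

end Decomp

/-! ## The certificate list and the star statement -/

section Certs

variable (R : Type*) [Field R] [LinearOrder R]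

/-- The typed set consists of pairs of marks. -/
def MarkPairs (o a₁ a₂ a₃ b : Fin 5) (F : Finset (Fin 10)) : Prop :=
  ∀ j ∈ F, ∀ v ∈ ends5 j, v = o ∨ v = a₁ ∨ v = a₂ ∨ v = a₃ ∨ v = b

/-- **The certificate list for one `(marking, T)`**: every copy-symmetrised piece that the census finds
nonnegative on every profile, for every typed set of mark pairs and every type map. -/
structure StarPieces (o a₁ a₂ a₃ b p₁ p₂ p₃ : Fin 5) : Prop where
  hN : ∀ F τ, MarkPairs o a₁ a₂ a₃ b F → 0 ≤ pN F (fun _ => false) τ (CovForm.K3 (R := R) ends5 o a₁ a₂ a₃ b)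
  hE : ∀ F τ, MarkPairs o a₁ a₂ a₃ b F → ∀ S, (S = pairMask p₁ p₂ ∨ S = pairMask p₁ p₃ ∨ S = pairMask p₂ p₃) →
    0 ≤ pE F (fun _ => false) τ (CovForm.K3 (R := R) ends5 o a₁ a₂ a₃ b) S
  hE2 : ∀ F τ, MarkPairs o a₁ a₂ a₃ b F → ∀ S, (S = pairMask p₁ p₂ ∨ S = pairMask p₁ p₃ ∨ S = pairMask p₂ p₃) →
    0 ≤ pE2 F (fun _ => false) τ (CovForm.K3 (R := R) ends5 o a₁ a₂ a₃ b) S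
  hT1 : ∀ F τ, MarkPairs o a₁ a₂ a₃ b F →
    0 ≤ pE F (fun _ => false) τ (CovForm.K3 (R := R) ends5 o a₁ a₂ a₃ b) (triMask p₁ p₂ p₃)
  hT2 : ∀ F τ, MarkPairs o a₁ a₂ a₃ b F →
    0 ≤ pE2 F (fun _ => false) τ (CovForm.K3 (R := R) ends5 o a₁ a₂ a₃ b) (triMask p₁ p₂ p₃)
  hM : ∀ F τ, MarkPairs o a₁ a₂ a₃ b F → ∀ S, (S = pairMask p₁ p₂ ∨ S = pairMask p₁ p₃ ∨ S = pairMask p₂ p₃) →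
    0 ≤ pM F (fun _ => false) τ (CovForm.K3 (R := R) ends5 o a₁ a₂ a₃ b) (triMask p₁ p₂ p₃) S
  hC : ∀ F τ, MarkPairs o a₁ a₂ a₃ b F → ∀ S S',
    ((S = pairMask p₁ p₂ ∧ S' = pairMask p₁ p₃) ∨ (S = pairMask p₁ p₂ ∧ S' = pairMask p₂ p₃) ∨
      (S = pairMask p₁ p₃ ∧ S' = pairMask p₂ p₃)) →
    0 ≤ pC F (fun _ => false) τ (CovForm.K3 (R := R) ends5 o a₁ a₂ a₃ b) S S' +
      pE F (fun _ => false) τ (CovForm.K3 (R := R) ends5 o a₁ a₂ a₃ b) (triMask p₁ p₂ p₃)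
  hTvT : ∃ S, (S = pairMask p₁ p₂ ∨ S = pairMask p₁ p₃ ∨ S = pairMask p₂ p₃) ∧
    ∀ F τ, MarkPairs o a₁ a₂ a₃ b F →
      0 ≤ pB F (fun _ => false) τ (CovForm.K3 (R := R) ends5 o a₁ a₂ a₃ b) (pairMask p₁ p₂)
          (pairMask p₁ p₃) (pairMask p₂ p₃) +
        pM F (fun _ => false) τ (CovForm.K3 (R := R) ends5 o a₁ a₂ a₃ b) (triMask p₁ p₂ p₃) S

variable {R}

/-- **`StarNonneg` at every mixed type vector from the certificate list.** -/
theorem starNonneg_of_pieces [IsStrictOrderedRing R] {o a₁ a₂ a₃ b p₁ p₂ p₃ : Fin 5}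
    (h : StarPieces R o a₁ a₂ a₃ b p₁ p₂ p₃) (t₁ t₂ t₃ : ℕ) (h1 : t₁ = 1 ∨ t₁ = 2) (h2 : t₂ = 1 ∨ t₂ = 2)
    (h3 : t₃ = 1 ∨ t₃ = 2) : StarNonneg R o a₁ a₂ a₃ b p₁ p₂ p₃ t₁ t₂ t₃ := by
  intro F τ hF
  set K := CovForm.K3 (R := R) ends5 o a₁ a₂ a₃ b with hK
  have hN := h.hN F τ hF
  have hE12 := h.hE F τ hF _ (Or.inl rfl)
  have hE13 := h.hE F τ hF _ (Or.inr (Or.inl rfl))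
  have hE23 := h.hE F τ hF _ (Or.inr (Or.inr rfl))
  have hE212 := h.hE2 F τ hF _ (Or.inl rfl)
  have hE213 := h.hE2 F τ hF _ (Or.inr (Or.inl rfl))
  have hE223 := h.hE2 F τ hF _ (Or.inr (Or.inr rfl))
  have hT1 := h.hT1 F τ hF
  have hT2 := h.hT2 F τ hF
  have hM12 := h.hM F τ hF _ (Or.inl rfl)
  have hM13 := h.hM F τ hF _ (Or.inr (Or.inl rfl))
  have hM23 := h.hM F τ hF _ (Or.inr (Or.inr rfl))
  have hC1213 := h.hC F τ hF _ _ (Or.inl ⟨rfl, rfl⟩)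
  have hC1223 := h.hC F τ hF _ _ (Or.inr (Or.inl ⟨rfl, rfl⟩))
  have hC1323 := h.hC F τ hF _ _ (Or.inr (Or.inr ⟨rfl, rfl⟩))
  obtain ⟨S, hS, hTvT⟩ := h.hTvT
  have hTvT' := hTvT F τ hF
  rcases h1 with rfl | rfl <;> rcases h2 with rfl | rfl <;> rcases h3 with rfl | rfl
  · rw [starSum_111_pieces]; linarith
  · rw [starSum_112_pieces]; linarith
  · rw [starSum_121_pieces]; linarith
  · rw [starSum_122_pieces]; linarith
  · rw [starSum_211_pieces]; linarith
  · rw [starSum_212_pieces]; linarith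
  · rw [starSum_221_pieces]; linarith
  · rw [starSum_222_pieces]
    rcases hS with rfl | rfl | rfl <;> linarith

end Certs

end K5

end Summit.Ventures.PercRepro2
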